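import Summits.BirchSwinnertonDyer.BirchSwinnertonDyer.Theorems.ThetaPartnerAtTwoPublishedInputsHeckeAtTwoOfThreeFacts
import Literature.NumberTheory.EllipticCurves.EichlerShimuraOptimalQuotientLatticeProofs
import HarnessLib

set_option linter.dupNamespace false -- `…BirchSwinnertonDyer.BirchSwinnertonDyer…` is the cell's nested layout (D-0017)
set_option autoImplicit false

/-!
# Item 27799 `EichlerShimuraDepletedOptimalQuotientInput` (aside alias on routes `ThetaPartnerAtTwo` and
# `ResidualThetaTransportAtTwo`) — the Eichler–Shimura period lattice of the depleted optimal quotient — PROVED BY NAME;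
# and the PUB⁵ bundle `PublishedInputsHeckeAtTwo` (stmt-BirchSwinnertonDyer-27435) FROM TWO print facts {Bz, AU}
# (LADDER-BSD inputs→unconditional; text by INPUTS seat `bsd-input-eichler-shimura-lat` g0, literature-prover, for a prover to file:
# `--kind proof --workitem stmt-BirchSwinnertonDyer-27799`; THEOREMS ONLY — no definition, no named fact, no `sorry`)

The item is the 1:1 alias — stated identically on BOTH habitat routes (`ThetaPartnerAtTwo` l.1022 and `ResidualThetaTransportAtTwo`
l.856, HOLD input «ES» of the PUB⁵ bundle `PublishedInputsHeckeAtTwo`, stmt-BirchSwinnertonDyer-27435) — of the named fact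
`Literature.NumberTheory.EllipticCurves.ModularForms.eichlerShimura_depletedOptimalQuotient_periodLattice_of_dvd` (for a rational newform
`f ∈ S₂(Γ₀(N))`, `S ≠ ∅` a finite set of primes, `N·∏_{ℓ∈S} ℓ² ∣ L` and the `S`-depleted form `g ∈ S₂(Γ₀(L))`: an elliptic curve `A/ℚ`,
globally minimal, with Néron lattice `c·Λ_g`, `c ∈ ℚ^×`, and `a_p(A) = a_p(g)` for almost all `p`). That fact is a THEOREM of the tree
since 2026-08-28 (`Literature/NumberTheory/EllipticCurves/EichlerShimuraOptimalQuotientLatticeProofs.lean`,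
`Literature.NumberTheory.EllipticCurves.ModularForms.eichlerShimura_depletedOptimalQuotient_periodLattice_of_dvd_holds`, seat
`bsd-input-eichler-shimura-lat` g0: `E_f = ℂ/Λ_f` over `ℚ`, `(∏ℓ²)Λ_g ⊆ Λ_f` (`NewformsDepletion.lean`, p662578), `A = ℂ/Λ_g` globally
minimal and `ℚ`-isogenous to `E_f` by analytic isogeny descent, `a_p` by `IsIsogenous.LFunction_eq` and the Eichler–Shimura congruence
`congruenceRelation_cofinite_of_int` (Honda); no modularity, standard axioms). §1 records the discharge against BOTH route declarations
by `unfold; exact`; §2 books the bundle: with ES, SD (`heckeSelfDual_torsionBy_J0_holds`, p661433) and Se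
(`serre1972_supersingular_decompositionSubgroup_image_holds`) theorems, `PublishedInputsHeckeAtTwo ⟺ Bz ∧ AU`
(`…OfThreeFacts.thetaPartner_of_esBzAu` fed with the ES theorem). Nothing is re-derived; no landed declaration is restated.

Honest framing: UNCONDITIONAL as typed (standard axioms) for §1; §2 is conditional glue on exactly {Bz = Buzzard 2000 Prop. 2.4,
AU = Abbes–Ullmo 1996 Thm. A}. Closing item 27799 turns the displayed HOLD input «ES» of row 1 into a theorem AS TYPED; no crux and
no summit statement is proved; the Birch–Swinnerton-Dyer conjecture is NOT proved by any of this.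
References: [Knapp1993] Thm. 11.74 (d)(e); [ShimuraIATAF1971] Thm. 7.14–7.15; [AgasheRibetStein2006] §2–§3; [AtkinLehner1970] §3;
[Buzzard2000LevelLoweringModTwo] Prop. 2.4; [AbbesUllmo1996] Thm. A.
-/

namespace Summit.BirchSwinnertonDyer.BirchSwinnertonDyer.Theorems.InputsSweep

/-! ## §1. Item 27799 on both routes -/

/-- **Item 27799 on route `ThetaPartnerAtTwo` — `EichlerShimuraDepletedOptimalQuotientInput` PROVED (by name)** from the tree's
discharge `eichlerShimura_depletedOptimalQuotient_periodLattice_of_dvd_holds`. Unconditional; closes item 27799; BSD is not proved by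
this. [cite: Knapp1993, Thm. 11.74 (d)(e)] [cite: AgasheRibetStein2006, §3 (pp. 620–621)] -/
theorem thetaPartnerAtTwo_eichlerShimuraDepletedOptimalQuotientInput_proof :
    Summit.BirchSwinnertonDyer.BirchSwinnertonDyer.Theses.ThetaPartnerAtTwo.EichlerShimuraDepletedOptimalQuotientInput := by
  unfold Summit.BirchSwinnertonDyer.BirchSwinnertonDyer.Theses.ThetaPartnerAtTwo.EichlerShimuraDepletedOptimalQuotientInput
  exact Literature.NumberTheory.EllipticCurves.ModularForms.eichlerShimura_depletedOptimalQuotient_periodLattice_of_dvd_holds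

/-- **Item 27799 on route `ResidualThetaTransportAtTwo` — the same alias, PROVED (by name)** from
`eichlerShimura_depletedOptimalQuotient_periodLattice_of_dvd_holds`. Unconditional; BSD is not proved by this.
[cite: Knapp1993, Thm. 11.74 (d)(e)] [cite: AgasheRibetStein2006, §3 (pp. 620–621)] -/
theorem residualThetaTransportAtTwo_eichlerShimuraDepletedOptimalQuotientInput_proof :
    Summit.BirchSwinnertonDyer.BirchSwinnertonDyer.Theses.ResidualThetaTransportAtTwo.EichlerShimuraDepletedOptimalQuotientInput := by
  unfold Summit.BirchSwinnertonDyer.BirchSwinnertonDyer.Theses.ResidualThetaTransportAtTwo.EichlerShimuraDepletedOptimalQuotientInput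
  exact Literature.NumberTheory.EllipticCurves.ModularForms.eichlerShimura_depletedOptimalQuotient_periodLattice_of_dvd_holds

end Summit.BirchSwinnertonDyer.BirchSwinnertonDyer.Theorems.InputsSweep

/-! ## §2. PUB⁵ `PublishedInputsHeckeAtTwo` (27435) from TWO print facts {Bz, AU} -/

namespace Summit.BirchSwinnertonDyer.BirchSwinnertonDyer.Theorems.PublishedInputsHeckeAtTwo

open Literature.NumberTheory.EllipticCurves Literature.NumberTheory.EllipticCurves.ModularForms

/-- **PUB² ⟹ PUB⁵ (route ThetaPartnerAtTwo)**: `PublishedInputsHeckeAtTwo` from Buzzard 2000 and Abbes–Ullmo Thm. A alone — ES by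
`eichlerShimura_depletedOptimalQuotient_periodLattice_of_dvd_holds`, SD and Se by their tree discharges (via `thetaPartner_of_esBzAu`).
CONDITIONAL on {Bz, AU}; BSD is not proved by this. [cite: Buzzard2000LevelLoweringModTwo, Prop. 2.4] [cite: AbbesUllmo1996, Thm. A] -/
theorem thetaPartner_of_bzAu (hBz : buzzard2000_multiplicityOne_gamma0)
    (hAU : abbesUllmo_not_dvd_maninConstant_of_not_dvd_level) :
    Summit.BirchSwinnertonDyer.BirchSwinnertonDyer.Theses.ThetaPartnerAtTwo.PublishedInputsHeckeAtTwo :=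
  thetaPartner_of_esBzAu eichlerShimura_depletedOptimalQuotient_periodLattice_of_dvd_holds hBz hAU

/-- **PUB⁵ ⟺ PUB² (route ThetaPartnerAtTwo)**: the HOLD bundle is EQUIVALENT to Bz ∧ AU. [cite: Buzzard2000LevelLoweringModTwo, Prop. 2.4]
[cite: AbbesUllmo1996, Thm. A] -/
theorem thetaPartner_iff_bzAu :
    Summit.BirchSwinnertonDyer.BirchSwinnertonDyer.Theses.ThetaPartnerAtTwo.PublishedInputsHeckeAtTwo ↔
      buzzard2000_multiplicityOne_gamma0 ∧ abbesUllmo_not_dvd_maninConstant_of_not_dvd_level :=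
  ⟨fun h ↦ ⟨h.2.2.1, h.2.2.2.2⟩, fun h ↦ thetaPartner_of_bzAu h.1 h.2⟩

/-- **PUB² ⟹ PUB⁵ (route ResidualThetaTransportAtTwo)** — the RTT copy of the bundle from {Bz, AU}. CONDITIONAL; BSD is not proved by
this. [cite: Buzzard2000LevelLoweringModTwo, Prop. 2.4] [cite: AbbesUllmo1996, Thm. A] -/
theorem residualThetaTransport_of_bzAu (hBz : buzzard2000_multiplicityOne_gamma0)
    (hAU : abbesUllmo_not_dvd_maninConstant_of_not_dvd_level) :
    Summit.BirchSwinnertonDyer.BirchSwinnertonDyer.Theses.ResidualThetaTransportAtTwo.PublishedInputsHeckeAtTwo :=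
  residualThetaTransport_of_esBzAu eichlerShimura_depletedOptimalQuotient_periodLattice_of_dvd_holds hBz hAU

/-- **PUB⁵ ⟺ PUB² (route ResidualThetaTransportAtTwo)**. [cite: Buzzard2000LevelLoweringModTwo, Prop. 2.4] [cite: AbbesUllmo1996, Thm. A] -/
theorem residualThetaTransport_iff_bzAu :
    Summit.BirchSwinnertonDyer.BirchSwinnertonDyer.Theses.ResidualThetaTransportAtTwo.PublishedInputsHeckeAtTwo ↔
      buzzard2000_multiplicityOne_gamma0 ∧ abbesUllmo_not_dvd_maninConstant_of_not_dvd_level :=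
  ⟨fun h ↦ ⟨h.2.2.1, h.2.2.2.2⟩, fun h ↦ residualThetaTransport_of_bzAu h.1 h.2⟩

end Summit.BirchSwinnertonDyer.BirchSwinnertonDyer.Theorems.PublishedInputsHeckeAtTwo
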